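import Summits.Ventures.PercRepro.ProfilePointedCircuitClassesStarSharpParXB

/-!
# PercRepro — THE REGIME `b ∥ y`, `y ∈ X`, OF CASE D0, PART C: THE `c1`-CLASS IS COUNTED BY THE OFF C-POINTS
(p5, gen 55; `proofs/P5-GM1.md` §82 ADD 7)

`parX_card_A_le_card_Coff`: the bad demands with `c1` are at most the OFF C-points of `X` (every such demand has an
OFF C-endpoint, part B, and an OFF C-point is an endpoint of at most one bad demand, part A);
`parX_off_target_mem`: an OFF C-point `x` gives the set `{e, f, x} + b`, bi-independent with bi-independent
complement — the fifth kind of target, absent from the four-kind split of the regime theorem of §82;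
`parX_card_Coff_le_targets`: the OFF C-points inject into that class.
-/

open scoped Matroid

namespace PercRepro.Cogirth

open Finset ThmH Skew Shadow Profile

open Classical

variable {α : Type} [DecidableEq α] {N : Matroid α} [N.Finite]

section StarSharpParXC

variable {b b' : α}

/-- **THE `c1`-CLASS IS AT MOST THE OFF C-POINTS** (regime `b ∥ y`). -/
theorem parX_card_A_le_card_Coff (hn : (gr N).card = 9) (h : SeriesPair N b b') {e f : α} (he : e ∈ gr N)
    (hf : f ∈ gr N) (hef : e ≠ f) (heb : e ≠ b) (heb' : e ≠ b') (hfb : f ≠ b) (hfb' : f ≠ b')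
    (he1 : ∀ y ∈ ((((gr N).erase b).erase b').erase f).erase e, rk N {e, y} = 2)
    (hf1 : ∀ y ∈ ((((gr N).erase b).erase b').erase f).erase e, rk N {f, y} = 2)
    (hfc : ∀ y ∈ ((((gr N).erase b).erase b').erase f).erase e, rk N (((((gr N).erase b).erase b').erase f).erase y) = 4)
    (hX : rk N (((((gr N).erase b).erase b').erase f).erase e) = 4)
    {y : α} (hyX : y ∈ ((((gr N).erase b).erase b').erase f).erase e) (hpar : rk N {y, b, b'} = 2)
    (hbb2 : rk N {b, b'} = 2) :
    ((d0DON N b' e f).filter (fun W => ¬ d0c0 N b b' e f W ∧ (d0c1 N b e f W ∧ ¬ d0c2 N b b' e f W))).card ≤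
      ((((((gr N).erase b).erase b').erase f).erase e).filter (fun x => rk N {e, f, x} = 3 ∧
        rk N ((((((gr N).erase b).erase b').erase f).erase e).erase x) = 4 ∧ rk N (insert y {e, f, x}) = 4)).card := by
  have hsub : (d0DON N b' e f).filter (fun W => ¬ d0c0 N b b' e f W ∧ (d0c1 N b e f W ∧ ¬ d0c2 N b b' e f W)) ⊆
      ((((((gr N).erase b).erase b').erase f).erase e).filter (fun x => rk N {e, f, x} = 3 ∧
        rk N ((((((gr N).erase b).erase b').erase f).erase e).erase x) = 4 ∧ rk N (insert y {e, f, x}) = 4)).biUnion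
        (fun x => (d0DON N b' e f).filter (fun W => ¬ d0c0 N b b' e f W ∧ (d0c1 N b e f W ∧ ¬ d0c2 N b b' e f W) ∧
          x ∈ (W.erase b).erase e)) := by
    intro W hW
    have hW' := mem_filter.1 hW
    obtain ⟨x, hxπ, hx3, hx4, hxoff⟩ := parX_off_cpoint_of_c1 hn h he hf hef heb heb' hfb hfb' he1 hf1 hfc hX hyX hpar
      hbb2 hW'.1 hW'.2.1 hW'.2.2.1 hW'.2.2.2
    have hWd := hW'.1
    simp only [d0DON, mem_filter] at hWd
    have hπX := (d0_demand_data h hn hf hef heb hfb hfb' (e := e) W hWd.1 hWd.2.1 hWd.2.2).2.1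
    exact mem_biUnion.2 ⟨x, mem_filter.2 ⟨hπX hxπ, hx3, hx4, hxoff⟩, mem_filter.2 ⟨hW'.1, hW'.2.1, hW'.2.2, hxπ⟩⟩
  refine (card_le_card hsub).trans (card_biUnion_le.trans ?_)
  have h1 : ∀ x ∈ ((((((gr N).erase b).erase b').erase f).erase e).filter (fun x => rk N {e, f, x} = 3 ∧
      rk N ((((((gr N).erase b).erase b').erase f).erase e).erase x) = 4 ∧ rk N (insert y {e, f, x}) = 4)),
      ((d0DON N b' e f).filter (fun W => ¬ d0c0 N b b' e f W ∧ (d0c1 N b e f W ∧ ¬ d0c2 N b b' e f W) ∧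
        x ∈ (W.erase b).erase e)).card ≤ 1 := by
    intro x hx
    have hx' := mem_filter.1 hx
    apply card_le_one.2
    intro W hW W' hW'
    have hW1 := mem_filter.1 hW
    have hW1' := mem_filter.1 hW'
    exact parX_private hn h he hf hef heb heb' hfb hfb' he1 hfc hyX hpar hbb2 hx'.1 hx'.2.1 hx'.2.2.2 hW1.1 hW1.2.1
      hW1.2.2.1.1 hW1.2.2.1.2 hW1.2.2.2 hW1'.1 hW1'.2.1 (fun h' => hW1'.2.2.1.2 h'.2) hW1'.2.2.2
  calc ∑ x ∈ ((((((gr N).erase b).erase b').erase f).erase e).filter (fun x => rk N {e, f, x} = 3 ∧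
        rk N ((((((gr N).erase b).erase b').erase f).erase e).erase x) = 4 ∧ rk N (insert y {e, f, x}) = 4)),
        ((d0DON N b' e f).filter (fun W => ¬ d0c0 N b b' e f W ∧ (d0c1 N b e f W ∧ ¬ d0c2 N b b' e f W) ∧
          x ∈ (W.erase b).erase e)).card
      ≤ ∑ _x ∈ ((((((gr N).erase b).erase b').erase f).erase e).filter (fun x => rk N {e, f, x} = 3 ∧
        rk N ((((((gr N).erase b).erase b').erase f).erase e).erase x) = 4 ∧ rk N (insert y {e, f, x}) = 4)), 1 :=
        sum_le_sum h1
    _ = _ := by rw [sum_const, smul_eq_mul, mul_one]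

/-- **THE FIFTH KIND OF TARGET**: an OFF C-point `x` gives `{e, f, x} + b`, bi-independent with bi-independent
complement. -/
theorem parX_off_target_mem (hn : (gr N).card = 9) (h : SeriesPair N b b') {e f : α} (he : e ∈ gr N) (hf : f ∈ gr N)
    (hef : e ≠ f) (heb : e ≠ b) (heb' : e ≠ b') (hfb : f ≠ b) (hfb' : f ≠ b')
    (he1 : ∀ y ∈ ((((gr N).erase b).erase b').erase f).erase e, rk N {e, y} = 2)
    {y : α} (hyX : y ∈ ((((gr N).erase b).erase b').erase f).erase e) (hpar : rk N {y, b, b'} = 2)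
    (hbb2 : rk N {b, b'} = 2) {x : α} (hx : x ∈ ((((gr N).erase b).erase b').erase f).erase e)
    (hefx : rk N {e, f, x} = 3) (hx4 : rk N ((((((gr N).erase b).erase b').erase f).erase e).erase x) = 4)
    (hoff : rk N (insert y {e, f, x}) = 4) :
    insert b {e, f, x} ∈ (biIndepSets N 4).filter (fun W => (f ∈ W ∧ b' ∉ W) ∧
      (e ∈ W ∧ b ∈ W ∧ (gr N \ W).erase b' ∈ biIndepSets N 4)) := by
  have hXE : ((((gr N).erase b).erase b').erase f).erase e ⊆ ((gr N).erase b).erase b' :=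
    (erase_subset _ _).trans (erase_subset _ _)
  have hXg : ((((gr N).erase b).erase b').erase f).erase e ⊆ gr N :=
    hXE.trans ((erase_subset _ _).trans (erase_subset _ _))
  have hfE : f ∈ ((gr N).erase b).erase b' := mem_erase.2 ⟨hfb', mem_erase.2 ⟨hfb, hf⟩⟩
  have heE : e ∈ ((gr N).erase b).erase b' := mem_erase.2 ⟨heb', mem_erase.2 ⟨heb, he⟩⟩
  have hy1 : rk N ({y} : Finset α) = 1 := by
    have h1 := rk_insert_le_add_one (N := N) he (X := ({y} : Finset α)) (singleton_subset_iff.2 (hXg hyX))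
    have h2 := rk_le_card' (M := N) ({y} : Finset α)
    rw [card_singleton] at h2
    rw [he1 y hyX] at h1
    omega
  have hbb' : b ≠ b' := h.2.2.1
  have hS : ({e, f, x} : Finset α) ⊆ ((gr N).erase b).erase b' := by
    intro w hw; simp only [mem_insert, mem_singleton] at hw
    rcases hw with rfl | rfl | rfl
    · exact heE
    · exact hfE
    · exact hXE hx
  have hS3' : ({e, f, x} : Finset α).card = 3 := by
    have hxe : x ≠ e := (mem_erase.1 hx).1
    have hxf : x ≠ f := (mem_erase.1 (mem_erase.1 hx).2).1
    rw [card_insert_of_notMem, card_pair hxf.symm]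
    simp only [mem_insert, mem_singleton, not_or]; exact ⟨hef, hxe.symm⟩
  simp only [mem_filter]
  refine ⟨?_, ⟨mem_insert_of_mem (mem_insert_of_mem (mem_insert_self _ _)), ?_⟩,
    mem_insert_of_mem (mem_insert_self _ _), mem_insert_self _ _, ?_⟩
  · rw [insert_b_mem_biIndepSets_iff h hn hS hS3', E7_sdiff_efx_eq]
    exact ⟨hefx, hx4⟩
  · intro h'
    simp only [mem_insert, mem_singleton] at h'
    rcases h' with h2 | h2 | h2 | h2
    · exact hbb' h2.symm
    · exact heb' h2.symm
    · exact hfb' h2.symm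
    · exact (mem_erase.1 (hXE hx)).1 h2.symm
  · rw [off_image_efx_iff h hn he hf hef heb heb' hfb hfb' hx]
    refine ⟨hx4, ?_⟩
    have h3 := rk_insert_bb'_bounds h hS
    have h4 : ¬ rk N (insert b (insert b' {e, f, x})) = rk N {e, f, x} + 1 := by
      rw [on_iff_of_parallel h (hXE hyX) hy1 hpar hbb2 hS, hoff, hefx]
      omega
    rw [hefx] at h3 h4
    omega

/-- The OFF C-points inject into the fifth kind of target. -/
theorem parX_card_Coff_le_targets (hn : (gr N).card = 9) (h : SeriesPair N b b') {e f : α} (he : e ∈ gr N)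
    (hf : f ∈ gr N) (hef : e ≠ f) (heb : e ≠ b) (heb' : e ≠ b') (hfb : f ≠ b) (hfb' : f ≠ b')
    (he1 : ∀ y ∈ ((((gr N).erase b).erase b').erase f).erase e, rk N {e, y} = 2)
    {y : α} (hyX : y ∈ ((((gr N).erase b).erase b').erase f).erase e) (hpar : rk N {y, b, b'} = 2)
    (hbb2 : rk N {b, b'} = 2) :
    ((((((gr N).erase b).erase b').erase f).erase e).filter (fun x => rk N {e, f, x} = 3 ∧
        rk N ((((((gr N).erase b).erase b').erase f).erase e).erase x) = 4 ∧ rk N (insert y {e, f, x}) = 4)).card ≤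
      ((biIndepSets N 4).filter (fun W => (f ∈ W ∧ b' ∉ W) ∧
        (e ∈ W ∧ b ∈ W ∧ (gr N \ W).erase b' ∈ biIndepSets N 4))).card := by
  apply card_le_card_of_injOn (fun x => insert b {e, f, x})
  · intro x hx
    have hx' := mem_filter.1 hx
    exact parX_off_target_mem hn h he hf hef heb heb' hfb hfb' he1 hyX hpar hbb2 hx'.1 hx'.2.1 hx'.2.2.1 hx'.2.2.2
  · intro x hx x' hx' hxx'
    have hx1 := (mem_filter.1 (mem_coe.1 hx)).1
    have hx1' := (mem_filter.1 (mem_coe.1 hx')).1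
    have hxb : x ≠ b := (mem_erase.1 ((erase_subset _ _) ((erase_subset _ _) ((erase_subset _ _) hx1)))).1
    have hxe : x ≠ e := (mem_erase.1 hx1).1
    have hxf : x ≠ f := (mem_erase.1 (mem_erase.1 hx1).2).1
    have hmem : x ∈ insert b ({e, f, x'} : Finset α) := by
      have hxx'' : insert b ({e, f, x} : Finset α) = insert b {e, f, x'} := hxx'
      rw [← hxx'']; exact mem_insert_of_mem (mem_insert_of_mem (mem_insert_of_mem (mem_singleton_self _)))
    simp only [mem_insert, mem_singleton] at hmem
    rcases hmem with h' | h' | h' | h'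
    · exact absurd h' hxb
    · exact absurd h' hxe
    · exact absurd h' hxf
    · exact h'

end StarSharpParXC

end PercRepro.Cogirth
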